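import Summits.QuantumAdvantage.QuantumAdvantage.Theorems.SymplecticPurityGraphStateSpectrum

/-!
# Crux `DlogGraphFlat` (stmt-QuantumAdvantage-10732), line `Sketch`: congruence counts

Stub `stub_dlogCongCount` of the skeleton `Cruxes/DlogGraphFlat/Lines/Sketch.lean` (sector A,
flank). Inside one multiplier class of the XOR-differential count of `x ↦ gˣ mod p` the
differential condition is a congruence on the value `y ∈ [0, 2ⁿ)`, read as a bit vector
`y : QReg n` through Batteries' little-endian `Nat.ofBits`, against its flip `y ⊕ a'`
(`(y ⊕ a') j = y j ⊻ a' j`). With `|a'| = #{j : a' j}`, `m(a') = min (|a'|, n − |a'|)` and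
`2ⁿ ≤ 2p`:

* ratio form `h · y ≡ y ⊕ a' (mod p)` with a multiplier `h ∉ {1, −1}`: at most `2^{m(a') + 1}`
  solutions `y`;
* product form `y · (y ⊕ a') ≡ K (mod p)`: at most `2^{m(a') + 2}` solutions `y`.

Proof. Split `y` along the support `T` of `a'`: `U = y ∧ a'`, `V = y ∧ ¬a'`, `A' = a'` as
numbers; bitwise, `y = U + V` and `y ⊕ a' = (A' − U) + V`. For a fixed pattern `y ∧ a'` (at most
`2^{|T|}` of them, as they are supported on `T`) the ratio condition
`(h + 1) U + (h − 1) V = A'` determines `V mod p` (`h ≠ 1`), and the product condition is a monic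
quadratic in `V` over the field `ZMod p` (at most two residues); a residue has at most two
representatives `V < 2ⁿ ≤ 2p`, and `y` is recovered from `(y ∧ a', V)`. Symmetrically with the
pattern `y ∧ ¬a'` fixed (at most `2^{n − |T|}` of them), using `h ≠ −1`, resp. the monic quadratic
in `U`. The better of the two sides gives the exponent `m(a')`.
-/

set_option linter.dupNamespace false -- D-0017: single-problem summit ⇒ `QuantumAdvantage.QuantumAdvantage` by design

namespace Summit.QuantumAdvantage.QuantumAdvantage.Theorems.SymplecticPurity

open Finset Literature.Computability.QuantumComplexity Literature.Computability.Cryptography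

/-! ### Bit vectors as numbers -/

/-- Additivity of `Nat.ofBits` along a bitwise splitting `[f j] = [g j] + [h j]`. [folklore] -/
private theorem ofBits_eq_add {n : ℕ} (f g h : Fin n → Bool)
    (H : ∀ j, (f j).toNat = (g j).toNat + (h j).toNat) :
    Nat.ofBits f = Nat.ofBits g + Nat.ofBits h := by
  induction n with
  | zero => simp
  | succ n ih =>
    rw [Nat.ofBits_succ, Nat.ofBits_succ, Nat.ofBits_succ,
      ih (f ∘ Fin.succ) (g ∘ Fin.succ) (h ∘ Fin.succ) (fun j => H j.succ), H 0]
    ring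

/-- `Nat.ofBits` is injective. [folklore] -/
private theorem eq_of_ofBits_eq {n : ℕ} {e e' : Fin n → Bool} (h : Nat.ofBits e = Nat.ofBits e') :
    e = e' := by
  funext t
  have := congrArg (fun v => v.testBit t.val) h
  simpa using this

/-- Splitting along a mask: `y = (y ∧ b) + (y ∧ ¬b)` as numbers. [folklore] -/
private theorem ofBits_split {n : ℕ} (y b : QReg n) :
    Nat.ofBits y = Nat.ofBits (fun j => y j && b j) + Nat.ofBits (fun j => y j && !b j) := by
  have H : ∀ u v : Bool, u.toNat = (u && v).toNat + (u && !v).toNat := by decide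
  exact ofBits_eq_add _ _ _ fun j => H (y j) (b j)

/-- Splitting the flip: `y ⊕ a' = ((y ⊕ a') ∧ a') + (y ∧ ¬a')` as numbers. [folklore] -/
private theorem ofBits_xor_split {n : ℕ} (y a' : QReg n) :
    Nat.ofBits (fun j => Bool.xor (y j) (a' j)) =
      Nat.ofBits (fun j => Bool.xor (y j) (a' j) && a' j) + Nat.ofBits (fun j => y j && !a' j) := by
  have H : ∀ u v : Bool, (Bool.xor u v).toNat = (Bool.xor u v && v).toNat + (u && !v).toNat := by
    decide
  exact ofBits_eq_add _ _ _ fun j => H (y j) (a' j)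

/-- On the support of `a'` the flip is the complement: `a' = ((y ⊕ a') ∧ a') + (y ∧ a')` as
numbers. [folklore] -/
private theorem ofBits_xor_add {n : ℕ} (y a' : QReg n) :
    Nat.ofBits a' =
      Nat.ofBits (fun j => Bool.xor (y j) (a' j) && a' j) + Nat.ofBits (fun j => y j && a' j) := by
  have H : ∀ u v : Bool, v.toNat = (Bool.xor u v && v).toNat + (u && v).toNat := by decide
  exact ofBits_eq_add _ _ _ fun j => H (y j) (a' j)

/-- A bit vector is determined by its restrictions to a mask and to the complementary mask.
[folklore] -/
private theorem eq_of_and_eq {n : ℕ} {y y' : QReg n} (b : QReg n)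
    (h₁ : (fun j => y j && b j) = fun j => y' j && b j)
    (h₂ : (fun j => y j && !b j) = fun j => y' j && !b j) : y = y' := by
  have H : ∀ u u' v : Bool, (u && v) = (u' && v) → (u && !v) = (u' && !v) → u = u' := by decide
  funext j
  exact H (y j) (y' j) (b j) (congrFun h₁ j) (congrFun h₂ j)

/-- The two sides of the congruences after the split `U = y ∧ a'`, `V = y ∧ ¬a'`, `A' = a'`:
`y = U + V` and `y ⊕ a' = A' − U + V`, in any commutative ring. [folklore] -/
private theorem cast_ofBits_split {n : ℕ} {R : Type*} [CommRing R] (y a' : QReg n) :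
    ((Nat.ofBits y : ℕ) : R) =
        (Nat.ofBits (fun j => y j && a' j) : R) + (Nat.ofBits (fun j => y j && !a' j) : R) ∧
      ((Nat.ofBits fun j => Bool.xor (y j) (a' j) : ℕ) : R) =
        (Nat.ofBits a' : R) - (Nat.ofBits (fun j => y j && a' j) : R) +
          (Nat.ofBits (fun j => y j && !a' j) : R) := by
  refine ⟨by rw [ofBits_split y a', Nat.cast_add], ?_⟩
  rw [ofBits_xor_split y a', ofBits_xor_add y a']
  push_cast
  ring

/-! ### Counting -/

/-- Patterns `y ∧ b` are supported on the support of `b`: at most `2^{|b|}` of them. [folklore] -/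
private theorem card_image_and_le {n : ℕ} (S : Finset (QReg n)) (b : QReg n) :
    (S.image fun y : QReg n => fun j => y j && b j).card ≤
      2 ^ (univ.filter fun j => b j = true).card := by
  rw [← card_powerset]
  refine card_le_card_of_injOn (fun w : QReg n => univ.filter fun j => w j = true) ?_ ?_
  · intro w hw
    obtain ⟨y, -, rfl⟩ := mem_image.1 (mem_coe.1 hw)
    refine mem_coe.2 (mem_powerset.2 fun j hj => ?_)
    simp only [mem_filter, mem_univ, true_and, Bool.and_eq_true] at hj ⊢
    exact hj.2
  · intro w _ w' _ hww'
    funext j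
    have hj := congrArg (fun s : Finset (Fin n) => j ∈ s) hww'
    simp only [mem_filter, mem_univ, true_and, eq_iff_iff] at hj
    exact Bool.eq_iff_iff.2 hj

/-- A monic quadratic over a domain has at most two roots. [folklore] -/
private theorem card_quadratic_roots_le {F : Type*} [CommRing F] [IsDomain F] [Fintype F]
    [DecidableEq F] (b c : F) : (univ.filter fun r : F => r * r + b * r + c = 0).card ≤ 2 := by
  by_cases h : ∃ r₁, r₁ * r₁ + b * r₁ + c = 0
  · obtain ⟨r₁, hr₁⟩ := h
    calc (univ.filter fun r : F => r * r + b * r + c = 0).card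
        ≤ ({r₁, -(r₁ + b)} : Finset F).card := by
          refine card_le_card fun r hr => ?_
          simp only [mem_filter, mem_univ, true_and] at hr
          have hprod : (r - r₁) * (r + (r₁ + b)) = 0 := by linear_combination hr - hr₁
          rcases mul_eq_zero.1 hprod with h | h
          · rw [sub_eq_zero] at h
            rw [h]
            exact mem_insert_self _ _
          · exact mem_insert.2 (Or.inr (mem_singleton.2 (eq_neg_of_add_eq_zero_left h)))
      _ ≤ 2 := card_le_two
  · refine le_trans (le_of_eq ?_) (Nat.zero_le 2)
    rw [card_eq_zero, filter_eq_empty_iff]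
    exact fun r _ hr => h ⟨r, hr⟩

/-- **Fibre count.** Points determined by a number `< 2p` whose residue lies in `R`: at most
`2 · #R` of them (a residue has at most two representatives below `2p`). [folklore] -/
private theorem card_le_two_mul_card {n p : ℕ} (hp : 0 < p) (F : Finset (QReg n))
    (c : QReg n → ℕ) (R : Finset (ZMod p)) (hc : ∀ y ∈ F, c y < 2 * p)
    (hR : ∀ y ∈ F, (c y : ZMod p) ∈ R) (hinj : ∀ y ∈ F, ∀ y' ∈ F, c y = c y' → y = y') :
    F.card ≤ 2 * R.card := by
  calc F.card ≤ (R ×ˢ range 2).card := by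
        refine card_le_card_of_injOn (fun y => ((c y : ZMod p), c y / p)) ?_ ?_
        · intro y hy
          exact mem_coe.2 (mem_product.2
            ⟨hR y hy, mem_range.2 ((Nat.div_lt_iff_lt_mul hp).2 (hc y hy))⟩)
        · intro y hy y' hy' h
          simp only [Prod.mk.injEq] at h
          refine hinj y hy y' hy' ?_
          rw [← Nat.div_add_mod (c y) p, ← Nat.div_add_mod (c y') p, h.2,
            (ZMod.natCast_eq_natCast_iff' _ _ _).1 h.1]
    _ = 2 * R.card := by rw [card_product, card_range, mul_comm]

/-- **Class count.** If every point of `S` is recovered from its pattern `y ∧ b` together with a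
number `c y < 2p` whose residue, for a fixed pattern, lies in a set of at most `k` residues, then
`#S ≤ 2^{|b|} · 2k`. [folklore] -/
private theorem card_le_pow_mul {n p : ℕ} (hp : 0 < p) (S : Finset (QReg n)) (b : QReg n)
    (c : QReg n → ℕ) (k : ℕ) (hc : ∀ y, c y < 2 * p)
    (hinj : ∀ y y' : QReg n, (fun j => y j && b j) = (fun j => y' j && b j) → c y = c y' → y = y')
    (hfib : ∀ y₀ ∈ S, ∃ R : Finset (ZMod p), R.card ≤ k ∧
      ∀ y ∈ S, (fun j => y j && b j) = (fun j => y₀ j && b j) → (c y : ZMod p) ∈ R) :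
    S.card ≤ 2 ^ (univ.filter fun j => b j = true).card * (2 * k) := by
  calc S.card ≤ 2 * k * (S.image fun y : QReg n => fun j => y j && b j).card := by
        refine card_le_mul_card_image S (2 * k) fun w hw => ?_
        obtain ⟨y₀, hy₀, rfl⟩ := mem_image.1 hw
        obtain ⟨R, hRk, hR⟩ := hfib y₀ hy₀
        refine (card_le_two_mul_card hp _ c R (fun y _ => hc y) (fun y hy => ?_)
          (fun y hy y' hy' hyy' => ?_)).trans (Nat.mul_le_mul_left 2 hRk)
        · exact hR y (mem_filter.1 hy).1 (mem_filter.1 hy).2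
        · exact hinj y y' (((mem_filter.1 hy).2).trans ((mem_filter.1 hy').2).symm) hyy'
    _ ≤ 2 * k * 2 ^ (univ.filter fun j => b j = true).card :=
        Nat.mul_le_mul_left _ (card_image_and_le S b)
    _ = 2 ^ (univ.filter fun j => b j = true).card * (2 * k) := mul_comm _ _

/-- Complement count: `#{j : ¬ a' j} = n − #{j : a' j}`. [folklore] -/
private theorem card_filter_not {n : ℕ} (a' : QReg n) :
    (univ.filter fun j => (!a' j) = true).card = n - (univ.filter fun j => a' j = true).card := by
  have : (univ.filter fun j => (!a' j) = true) = (univ.filter fun j => a' j = true)ᶜ := by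
    ext j; simp
  rw [this, card_compl, Fintype.card_fin]

/-! ### The two congruence counts -/

/-- **Ratio form.** For a prime `p` with `2ⁿ ≤ 2p` and a multiplier `h ∉ {1, −1}`:
`#{y : h · y ≡ y ⊕ a'} ≤ 2^{m(a') + 1}`. -/
private theorem cong_linear {n p : ℕ} (hp : p.Prime) (hnp : 2 ^ n ≤ 2 * p) (a' : QReg n)
    (h : ZMod p) (h1 : h ≠ 1) (hm1 : h ≠ -1) :
    (Finset.univ.filter fun y : QReg n =>
        h * (Nat.ofBits y : ZMod p) = (Nat.ofBits (fun j => Bool.xor (y j) (a' j)) : ZMod p)).card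
      ≤ 2 ^ (min (Finset.univ.filter fun j => a' j = true).card
            (n - (Finset.univ.filter fun j => a' j = true).card) + 1) := by
  haveI : Fact p.Prime := ⟨hp⟩
  have h1' : h - 1 ≠ 0 := sub_ne_zero.2 h1
  have hm1' : h + 1 ≠ 0 := fun e => hm1 (eq_neg_of_add_eq_zero_left e)
  have hlt : ∀ w : QReg n, Nat.ofBits w < 2 * p := fun w => (Nat.ofBits_lt_two_pow w).trans_le hnp
  suffices main : ∀ S : Finset (QReg n),
      (∀ y ∈ S, h * (Nat.ofBits y : ZMod p) =
        (Nat.ofBits (fun j => Bool.xor (y j) (a' j)) : ZMod p)) →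
      S.card ≤ 2 ^ (min (univ.filter fun j => a' j = true).card
        (n - (univ.filter fun j => a' j = true).card) + 1) by
    exact main _ fun y hy => (mem_filter.1 hy).2
  intro S hS
  -- the linear relation `(h + 1) U + (h - 1) V = A'` on `S`
  have key : ∀ y ∈ S, (h + 1) * (Nat.ofBits (fun j => y j && a' j) : ZMod p) +
      (h - 1) * (Nat.ofBits (fun j => y j && !a' j) : ZMod p) = (Nat.ofBits a' : ZMod p) := by
    intro y hy
    obtain ⟨e₁, e₂⟩ := cast_ofBits_split (R := ZMod p) y a'
    linear_combination hS y hy - h * e₁ + e₂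
  -- fix the pattern on the support of `a'`: `V mod p` is determined
  have bU : S.card ≤ 2 ^ (univ.filter fun j => a' j = true).card * (2 * 1) := by
    refine card_le_pow_mul hp.pos S a' (fun y => Nat.ofBits fun j => y j && !a' j) 1
      (fun y => hlt _) (fun y y' e₁ e₂ => eq_of_and_eq a' e₁ (eq_of_ofBits_eq e₂))
      fun y₀ hy₀ => ?_
    refine ⟨{((Nat.ofBits a' : ZMod p) -
        (h + 1) * (Nat.ofBits (fun j => y₀ j && a' j) : ZMod p)) / (h - 1)},
      (card_singleton _).le, fun y hy hyy₀ => ?_⟩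
    have k := key y hy
    rw [show (Nat.ofBits fun j => y j && a' j) = Nat.ofBits fun j => y₀ j && a' j from
      congrArg Nat.ofBits hyy₀] at k
    rw [mem_singleton, eq_div_iff h1']
    linear_combination k
  -- fix the pattern off the support of `a'`: `U mod p` is determined
  have bV : S.card ≤ 2 ^ (n - (univ.filter fun j => a' j = true).card) * (2 * 1) := by
    rw [← card_filter_not a']
    refine card_le_pow_mul hp.pos S (fun j => !a' j) (fun y => Nat.ofBits fun j => y j && a' j) 1
      (fun y => hlt _) (fun y y' e₁ e₂ => eq_of_and_eq a' (eq_of_ofBits_eq e₂) e₁)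
      fun y₀ hy₀ => ?_
    refine ⟨{((Nat.ofBits a' : ZMod p) -
        (h - 1) * (Nat.ofBits (fun j => y₀ j && !a' j) : ZMod p)) / (h + 1)},
      (card_singleton _).le, fun y hy hyy₀ => ?_⟩
    have k := key y hy
    rw [show (Nat.ofBits fun j => y j && !a' j) = Nat.ofBits fun j => y₀ j && !a' j from
      congrArg Nat.ofBits hyy₀] at k
    rw [mem_singleton, eq_div_iff hm1']
    linear_combination k
  rcases le_total (univ.filter fun j => a' j = true).card
      (n - (univ.filter fun j => a' j = true).card) with hle | hle
  · rw [min_eq_left hle, pow_succ]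
    simpa only [mul_one] using bU
  · rw [min_eq_right hle, pow_succ]
    simpa only [mul_one] using bV

/-- **Product form.** For a prime `p` with `2ⁿ ≤ 2p`: `#{y : y · (y ⊕ a') ≡ K} ≤ 2^{m(a') + 2}`. -/
private theorem cong_quadratic {n p : ℕ} (hp : p.Prime) (hnp : 2 ^ n ≤ 2 * p) (a' : QReg n)
    (K : ZMod p) :
    (Finset.univ.filter fun y : QReg n =>
        (Nat.ofBits y : ZMod p) * (Nat.ofBits (fun j => Bool.xor (y j) (a' j)) : ZMod p) = K).card
      ≤ 2 ^ (min (Finset.univ.filter fun j => a' j = true).card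
            (n - (Finset.univ.filter fun j => a' j = true).card) + 2) := by
  haveI : Fact p.Prime := ⟨hp⟩
  haveI : NeZero p := ⟨hp.ne_zero⟩
  have hlt : ∀ w : QReg n, Nat.ofBits w < 2 * p := fun w => (Nat.ofBits_lt_two_pow w).trans_le hnp
  suffices main : ∀ S : Finset (QReg n),
      (∀ y ∈ S, (Nat.ofBits y : ZMod p) *
        (Nat.ofBits (fun j => Bool.xor (y j) (a' j)) : ZMod p) = K) →
      S.card ≤ 2 ^ (min (univ.filter fun j => a' j = true).card
        (n - (univ.filter fun j => a' j = true).card) + 2) by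
    exact main _ fun y hy => (mem_filter.1 hy).2
  intro S hS
  -- the quadratic relation `(U + V) (A' - U + V) = K` on `S`
  have key : ∀ y ∈ S, ((Nat.ofBits (fun j => y j && a' j) : ZMod p) +
        (Nat.ofBits (fun j => y j && !a' j) : ZMod p)) *
      ((Nat.ofBits a' : ZMod p) - (Nat.ofBits (fun j => y j && a' j) : ZMod p) +
        (Nat.ofBits (fun j => y j && !a' j) : ZMod p)) = K := by
    intro y hy
    obtain ⟨e₁, e₂⟩ := cast_ofBits_split (R := ZMod p) y a'
    rw [← e₁, ← e₂]
    exact hS y hy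
  -- fix the pattern on the support of `a'`: `V mod p` is a root of a monic quadratic
  have bU : S.card ≤ 2 ^ (univ.filter fun j => a' j = true).card * (2 * 2) := by
    refine card_le_pow_mul hp.pos S a' (fun y => Nat.ofBits fun j => y j && !a' j) 2
      (fun y => hlt _) (fun y y' e₁ e₂ => eq_of_and_eq a' e₁ (eq_of_ofBits_eq e₂))
      fun y₀ hy₀ => ?_
    refine ⟨univ.filter fun r : ZMod p => r * r + (Nat.ofBits a' : ZMod p) * r +
        ((Nat.ofBits (fun j => y₀ j && a' j) : ZMod p) *
          ((Nat.ofBits a' : ZMod p) - (Nat.ofBits (fun j => y₀ j && a' j) : ZMod p)) - K) = 0,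
      card_quadratic_roots_le _ _, fun y hy hyy₀ => ?_⟩
    have k := key y hy
    rw [show (Nat.ofBits fun j => y j && a' j) = Nat.ofBits fun j => y₀ j && a' j from
      congrArg Nat.ofBits hyy₀] at k
    simp only [mem_filter, mem_univ, true_and]
    linear_combination k
  -- fix the pattern off the support of `a'`: `U mod p` is a root of a monic quadratic
  have bV : S.card ≤ 2 ^ (n - (univ.filter fun j => a' j = true).card) * (2 * 2) := by
    rw [← card_filter_not a']
    refine card_le_pow_mul hp.pos S (fun j => !a' j) (fun y => Nat.ofBits fun j => y j && a' j) 2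
      (fun y => hlt _) (fun y y' e₁ e₂ => eq_of_and_eq a' (eq_of_ofBits_eq e₂) e₁)
      fun y₀ hy₀ => ?_
    refine ⟨univ.filter fun r : ZMod p => r * r + (-(Nat.ofBits a' : ZMod p)) * r +
        (K - (Nat.ofBits a' : ZMod p) * (Nat.ofBits (fun j => y₀ j && !a' j) : ZMod p) -
          (Nat.ofBits (fun j => y₀ j && !a' j) : ZMod p) *
            (Nat.ofBits (fun j => y₀ j && !a' j) : ZMod p)) = 0,
      card_quadratic_roots_le _ _, fun y hy hyy₀ => ?_⟩
    have k := key y hy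
    rw [show (Nat.ofBits fun j => y j && !a' j) = Nat.ofBits fun j => y₀ j && !a' j from
      congrArg Nat.ofBits hyy₀] at k
    simp only [mem_filter, mem_univ, true_and]
    linear_combination (-1 : ZMod p) * k
  rcases le_total (univ.filter fun j => a' j = true).card
      (n - (univ.filter fun j => a' j = true).card) with hle | hle
  · rw [min_eq_left hle, pow_add, pow_two]
    exact bU
  · rw [min_eq_right hle, pow_add, pow_two]
    exact bV

/-- **Stub `stub_dlogCongCount` (sector A: congruence counts inside one multiplier class).**
For a prime `p` with `2ⁿ ≤ 2p` and a flip pattern `a' : QReg n` with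
`m(a') = min (|a'|, n − |a'|)`: the ratio congruence `h · y ≡ y ⊕ a' (mod p)` with `h ∉ {1, −1}`
has at most `2^{m(a') + 1}` solutions `y : QReg n`, and the product congruence
`y · (y ⊕ a') ≡ K (mod p)` has at most `2^{m(a') + 2}` (numbers read by `Nat.ofBits`).
Linear, resp. monic quadratic, congruence in the free half of the split `y = (y ∧ a') + (y ∧ ¬a')`,
two representatives below `2p` per residue. -/
theorem stub_dlogCongCount : ∀ (n p : ℕ), p.Prime → 2 ^ n ≤ 2 * p → ∀ a' : QReg n,
    (∀ h : ZMod p, h ≠ 1 → h ≠ -1 →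
      (Finset.univ.filter fun y : QReg n =>
          h * (Nat.ofBits y : ZMod p) = (Nat.ofBits (fun j => Bool.xor (y j) (a' j)) : ZMod p)).card
        ≤ 2 ^ (min (Finset.univ.filter fun j => a' j = true).card
              (n - (Finset.univ.filter fun j => a' j = true).card) + 1)) ∧
    (∀ K : ZMod p,
      (Finset.univ.filter fun y : QReg n =>
          (Nat.ofBits y : ZMod p) * (Nat.ofBits (fun j => Bool.xor (y j) (a' j)) : ZMod p) = K).card
        ≤ 2 ^ (min (Finset.univ.filter fun j => a' j = true).card
              (n - (Finset.univ.filter fun j => a' j = true).card) + 2)) :=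
  fun _ _ hp hnp a' =>
    ⟨fun h h1 hm1 => cong_linear hp hnp a' h h1 hm1, fun K => cong_quadratic hp hnp a' K⟩

end Summit.QuantumAdvantage.QuantumAdvantage.Theorems.SymplecticPurity
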